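import Summits.NavierStokesRegularity.NavierStokesRegularity.Theorems.FrozenSignCascadeBoundedEnvelopeContinuationMorreyOfEnvelope
import HarnessLib

/-!
# Route FrozenSignCascade · crux `BoundedEnvelopeContinuation` — the threshold regime, part 1:
# the Morrey constant at SMALL scales is governed by the HIGH-FREQUENCY critical envelope

Helper file for the crux item stmt-NavierStokesRegularity-10579 (`BoundedEnvelopeContinuation`,
conjunct (B) of route `FrozenSignCascade`), line `registered`; lands `--supports` that item.
Refinement of stub A (`stub_morreyOfEnvelope`, `PM² ⊂ Ṁ^{2,1}`, lead c1) with a frequency cutoff.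

**Theorem (`morrey_of_envelope_highFreq`).** There is a universal `κ₂ ≥ 0` such that for every
continuous, polynomially decaying coefficient field `f` on `ℝ³` with critical envelope
`‖ξ‖² ‖f ξ‖ ≤ C` everywhere and `‖ξ‖² ‖f ξ‖ ≤ δ` at the high frequencies `‖ξ‖ ≥ R`, the
synthesized velocity `u = synthVel f = Re 𝓕 f` satisfies

  `∫_{B_r(x₁)} ‖u‖² ≤ κ₂ δ² r`   for every radius `r` with `r R ≤ 1` and `C R r ≤ δ`,

i.e. at scales below `min(1/R, δ/(CR))` the scale-invariant local energy sees only the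
high-frequency envelope `δ`. Proof as for stub A with the sharp cutoff at `ρ = 1/r ≥ R`
(`MorreySharp.*` of lead c1): the HIGH part `1_{‖ξ‖>ρ} f` is bounded by `δ ‖ξ‖⁻²`, so Plancherel
gives `∫ (Re 𝓕)² ≤ 3|B₁| δ² ρ⁻¹` per component (`lintegral_sq_re_fourier_high_le_of_tail`); the
LOW part is bounded pointwise by `∫_{‖ξ‖≤R} C‖ξ‖⁻² + ∫_{R<‖ξ‖≤ρ} δ‖ξ‖⁻² ≤ 3|B₁|(C R + δ ρ)`
(`sq_re_fourier_low_le_of_tail`), and `C R + δ ρ ≤ 2 δ ρ` in the stated range of radii, whence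
`∫_{B_r} ‖u‖² ≤ (216 |B₁|³ + 18 |B₁|) δ² r`.

This is the Fourier-side input of the THRESHOLD theorem of the line (sequel files): the record
zoom only sees vanishing radii, so the zoom limit inherits the Morrey constant `κ₂ δ²/ν²` of the
high-frequency envelope alone, and the small-Morrey Liouville theorem
(`liouvilleMorrey_small`, `…LiouvilleMorreySmall.lean`) applies as soon as `δ ≤ c₁ ν`.

References: P. G. Lemarié-Rieusset, *The Navier–Stokes problem in the 21st century* (2016),
§8.5; M. Cannone, *Handbook of Mathematical Fluid Dynamics* III (2004), §2.4; folklore.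
-/

noncomputable section

set_option linter.dupNamespace false -- nested layout Summit.<S>.<Sub>, Sub = S (D-0017)

open MeasureTheory Set Metric Real Filter Topology
open scoped FourierTransform RealInnerProductSpace ENNReal
open Literature.Analysis.FluidPDE.FourierNS

namespace Summit.NavierStokesRegularity.NavierStokesRegularity.Theorems.BoundedEnvelope

namespace MorreyThreshold

/-- **Low frequencies, pointwise, with a cutoff**: if `g` is integrable, `‖g ξ‖ ≤ C ‖ξ‖⁻²` off
the origin and `‖g ξ‖ ≤ δ ‖ξ‖⁻²` for `‖ξ‖ ≥ R` (`R > 0`), then for `ρ ≥ R`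
`(Re 𝓕(1_{‖ξ‖ ≤ ρ} g)(x))² ≤ (3|B₁| (C R + δ ρ))²` for every `x` (`|𝓕 h| ≤ ∫ |h|`, and the
integrand is `≤ C 1_{‖ξ‖≤R} ‖ξ‖⁻² + δ 1_{‖ξ‖≤ρ} ‖ξ‖⁻²`). [folklore] -/
theorem sq_re_fourier_low_le_of_tail {g : (EuclideanSpace ℝ (Fin 3)) → ℂ} {C δ R ρ : ℝ} (hC : 0 ≤ C) (hδ : 0 ≤ δ)
    (hR : 0 < R) (hρ : R ≤ ρ) (hgi : Integrable g)
    (hg : ∀ ξ, ξ ≠ 0 → ‖g ξ‖ ≤ C * (‖ξ‖ ^ 2)⁻¹)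
    (hgt : ∀ ξ, R ≤ ‖ξ‖ → ‖g ξ‖ ≤ δ * (‖ξ‖ ^ 2)⁻¹) (x : (EuclideanSpace ℝ (Fin 3))) :
    (𝓕 ({ξ : (EuclideanSpace ℝ (Fin 3)) | ‖ξ‖ ≤ ρ}.indicator g) x).re ^ 2 ≤
      (3 * (volume (ball (0 : (EuclideanSpace ℝ (Fin 3))) 1)).toReal * (C * R + δ * ρ)) ^ 2 := by
  set VB : ℝ := (volume (ball (0 : (EuclideanSpace ℝ (Fin 3))) 1)).toReal with hVB
  have hVB0 : 0 ≤ VB := ENNReal.toReal_nonneg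
  have hρ0 : 0 ≤ ρ := hR.le.trans hρ
  have hSm : MeasurableSet {ξ : (EuclideanSpace ℝ (Fin 3)) | ‖ξ‖ ≤ ρ} :=
    (isClosed_le continuous_norm continuous_const).measurableSet
  -- the dominating function
  set D : (EuclideanSpace ℝ (Fin 3)) → ℝ := fun ξ => C * {ζ : (EuclideanSpace ℝ (Fin 3)) | ‖ζ‖ ≤ R}.indicator (fun ζ => (‖ζ‖ ^ 2)⁻¹) ξ +
    δ * {ζ : (EuclideanSpace ℝ (Fin 3)) | ‖ζ‖ ≤ ρ}.indicator (fun ζ => (‖ζ‖ ^ 2)⁻¹) ξ with hD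
  have hDi : Integrable D :=
    ((MorreySharp.integrable_ball_inv_norm_sq R).const_mul C).add
      ((MorreySharp.integrable_ball_inv_norm_sq ρ).const_mul δ)
  have hint : ∫ ξ, ‖{ξ : (EuclideanSpace ℝ (Fin 3)) | ‖ξ‖ ≤ ρ}.indicator g ξ‖ ≤ 3 * VB * (C * R + δ * ρ) := by
    calc ∫ ξ, ‖{ξ : (EuclideanSpace ℝ (Fin 3)) | ‖ξ‖ ≤ ρ}.indicator g ξ‖ ≤ ∫ ξ, D ξ := by
          refine integral_mono_ae (hgi.indicator hSm).norm hDi ?_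
          filter_upwards [Measure.ae_ne volume (0 : (EuclideanSpace ℝ (Fin 3)))] with ξ hξ
          have hi1 : 0 ≤ {ζ : (EuclideanSpace ℝ (Fin 3)) | ‖ζ‖ ≤ R}.indicator (fun ζ => (‖ζ‖ ^ 2)⁻¹) ξ :=
            indicator_nonneg (fun ζ _ => by positivity) _
          have hi2 : 0 ≤ {ζ : (EuclideanSpace ℝ (Fin 3)) | ‖ζ‖ ≤ ρ}.indicator (fun ζ => (‖ζ‖ ^ 2)⁻¹) ξ :=
            indicator_nonneg (fun ζ _ => by positivity) _
          by_cases hξS : ξ ∈ {ξ : (EuclideanSpace ℝ (Fin 3)) | ‖ξ‖ ≤ ρ}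
          · rw [indicator_of_mem hξS]
            by_cases hξR : ‖ξ‖ ≤ R
            · have hm : ξ ∈ {ζ : (EuclideanSpace ℝ (Fin 3)) | ‖ζ‖ ≤ R} := hξR
              calc ‖g ξ‖ ≤ C * (‖ξ‖ ^ 2)⁻¹ := hg ξ hξ
                _ = C * {ζ : (EuclideanSpace ℝ (Fin 3)) | ‖ζ‖ ≤ R}.indicator (fun ζ => (‖ζ‖ ^ 2)⁻¹) ξ := by
                    rw [indicator_of_mem hm]
                _ ≤ D ξ := by rw [hD]; exact le_add_of_nonneg_right (mul_nonneg hδ hi2)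
            · push Not at hξR
              calc ‖g ξ‖ ≤ δ * (‖ξ‖ ^ 2)⁻¹ := hgt ξ hξR.le
                _ = δ * {ζ : (EuclideanSpace ℝ (Fin 3)) | ‖ζ‖ ≤ ρ}.indicator (fun ζ => (‖ζ‖ ^ 2)⁻¹) ξ := by
                    rw [indicator_of_mem hξS]
                _ ≤ D ξ := by rw [hD]; exact le_add_of_nonneg_left (mul_nonneg hC hi1)
          · rw [indicator_of_notMem hξS, norm_zero]
            exact add_nonneg (mul_nonneg hC hi1) (mul_nonneg hδ hi2)
      _ = (C * ∫ ξ, {ζ : (EuclideanSpace ℝ (Fin 3)) | ‖ζ‖ ≤ R}.indicator (fun ζ => (‖ζ‖ ^ 2)⁻¹) ξ) +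
            δ * ∫ ξ, {ζ : (EuclideanSpace ℝ (Fin 3)) | ‖ζ‖ ≤ ρ}.indicator (fun ζ => (‖ζ‖ ^ 2)⁻¹) ξ := by
          rw [hD, integral_add ((MorreySharp.integrable_ball_inv_norm_sq R).const_mul C)
            ((MorreySharp.integrable_ball_inv_norm_sq ρ).const_mul δ), integral_const_mul,
            integral_const_mul]
      _ ≤ C * (3 * VB * R) + δ * (3 * VB * ρ) :=
          add_le_add (mul_le_mul_of_nonneg_left (MorreySharp.integral_ball_inv_norm_sq_le hR.le) hC)
            (mul_le_mul_of_nonneg_left (MorreySharp.integral_ball_inv_norm_sq_le hρ0) hδ)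
      _ = 3 * VB * (C * R + δ * ρ) := by ring
  have h1 : |(𝓕 ({ξ : (EuclideanSpace ℝ (Fin 3)) | ‖ξ‖ ≤ ρ}.indicator g) x).re| ≤ 3 * VB * (C * R + δ * ρ) :=
    calc |(𝓕 ({ξ : (EuclideanSpace ℝ (Fin 3)) | ‖ξ‖ ≤ ρ}.indicator g) x).re|
        ≤ ‖𝓕 ({ξ : (EuclideanSpace ℝ (Fin 3)) | ‖ξ‖ ≤ ρ}.indicator g) x‖ := Complex.abs_re_le_norm _
      _ ≤ ∫ ξ, ‖{ξ : (EuclideanSpace ℝ (Fin 3)) | ‖ξ‖ ≤ ρ}.indicator g ξ‖ :=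
          VectorFourier.norm_fourierIntegral_le_integral_norm _ _ _ _ _
      _ ≤ _ := hint
  calc (𝓕 ({ξ : (EuclideanSpace ℝ (Fin 3)) | ‖ξ‖ ≤ ρ}.indicator g) x).re ^ 2
      = |(𝓕 ({ξ : (EuclideanSpace ℝ (Fin 3)) | ‖ξ‖ ≤ ρ}.indicator g) x).re| ^ 2 := (sq_abs _).symm
    _ ≤ _ := pow_le_pow_left₀ (abs_nonneg _) h1 2

/-- **High frequencies, by Plancherel, with the tail envelope only**: if `g` is continuous with
decay of order `4` and `‖g ξ‖ ≤ δ ‖ξ‖⁻²` for `‖ξ‖ > ρ` (`ρ > 0`), then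
`∫ (Re 𝓕(1_{‖ξ‖ > ρ} g))² dx ≤ δ² · 3|B₁| ρ⁻¹`. [folklore] -/
theorem lintegral_sq_re_fourier_high_le_of_tail {g : (EuclideanSpace ℝ (Fin 3)) → ℂ} {δ ρ B : ℝ} (hρ : 0 < ρ)
    (hgc : Continuous g) (hB : HasDecay 4 B g)
    (hg : ∀ ξ, ρ < ‖ξ‖ → ‖g ξ‖ ≤ δ * (‖ξ‖ ^ 2)⁻¹) :
    ∫⁻ x, ENNReal.ofReal ((𝓕 ({ξ : (EuclideanSpace ℝ (Fin 3)) | ‖ξ‖ ≤ ρ}ᶜ.indicator g) x).re ^ 2) ≤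
      ENNReal.ofReal (δ ^ 2 * (3 * (volume (ball (0 : (EuclideanSpace ℝ (Fin 3))) 1)).toReal * ρ⁻¹)) := by
  have hSm : MeasurableSet {ξ : (EuclideanSpace ℝ (Fin 3)) | ‖ξ‖ ≤ ρ} :=
    (isClosed_le continuous_norm continuous_const).measurableSet
  have h3 : Fintype.card (Fin 3) < 4 := by simp
  have hdec : HasDecay 4 B ({ξ : (EuclideanSpace ℝ (Fin 3)) | ‖ξ‖ ≤ ρ}ᶜ.indicator g) := fun ξ =>
    (norm_indicator_le_norm_self g ξ).trans (hB ξ)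
  have hmeas : AEStronglyMeasurable ({ξ : (EuclideanSpace ℝ (Fin 3)) | ‖ξ‖ ≤ ρ}ᶜ.indicator g) volume :=
    hgc.aestronglyMeasurable.indicator hSm.compl
  have hint : Integrable ({ξ : (EuclideanSpace ℝ (Fin 3)) | ‖ξ‖ ≤ ρ}ᶜ.indicator g) :=
    hdec.integrable (finrank_lt_of_card_lt h3) hmeas
  have hI := MorreySharp.integrable_tail_inv_norm_four hρ
  calc ∫⁻ x, ENNReal.ofReal ((𝓕 ({ξ : (EuclideanSpace ℝ (Fin 3)) | ‖ξ‖ ≤ ρ}ᶜ.indicator g) x).re ^ 2)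
      ≤ ∫⁻ x, ‖𝓕 ({ξ : (EuclideanSpace ℝ (Fin 3)) | ‖ξ‖ ≤ ρ}ᶜ.indicator g) x‖ₑ ^ 2 :=
        lintegral_mono fun x => ofReal_re_sq_le _
    _ = ∫⁻ ξ, ‖{ξ : (EuclideanSpace ℝ (Fin 3)) | ‖ξ‖ ≤ ρ}ᶜ.indicator g ξ‖ₑ ^ 2 :=
        lintegral_sq_fourier_eq hint (memLp_two_of_hasDecay h3 hdec hmeas)
    _ ≤ ∫⁻ ξ, ENNReal.ofReal
          (δ ^ 2 * {η : (EuclideanSpace ℝ (Fin 3)) | ‖η‖ ≤ ρ}ᶜ.indicator (fun η => (‖η‖ ^ 4)⁻¹) ξ) := by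
        refine lintegral_mono fun ξ => ?_
        rw [← ofReal_norm, ← ENNReal.ofReal_pow (norm_nonneg _)]
        refine ENNReal.ofReal_le_ofReal ?_
        by_cases hξS : ξ ∈ {ξ : (EuclideanSpace ℝ (Fin 3)) | ‖ξ‖ ≤ ρ}ᶜ
        · rw [indicator_of_mem hξS, indicator_of_mem hξS]
          simp only [mem_compl_iff, mem_setOf_eq, not_le] at hξS
          calc ‖g ξ‖ ^ 2 ≤ (δ * (‖ξ‖ ^ 2)⁻¹) ^ 2 := pow_le_pow_left₀ (norm_nonneg _) (hg ξ hξS) 2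
            _ = δ ^ 2 * (‖ξ‖ ^ 4)⁻¹ := by ring
        · rw [indicator_of_notMem hξS, indicator_of_notMem hξS]
          simp
    _ = ENNReal.ofReal
          (∫ ξ, δ ^ 2 * {η : (EuclideanSpace ℝ (Fin 3)) | ‖η‖ ≤ ρ}ᶜ.indicator (fun η => (‖η‖ ^ 4)⁻¹) ξ) := by
        rw [← ofReal_integral_eq_lintegral_ofReal (hI.const_mul _)
          (Eventually.of_forall fun ξ =>
            mul_nonneg (sq_nonneg _) (indicator_nonneg (fun η _ => by positivity) _))]
    _ ≤ _ := by
        refine ENNReal.ofReal_le_ofReal ?_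
        rw [integral_const_mul]
        exact mul_le_mul_of_nonneg_left (MorreySharp.integral_tail_inv_norm_four_le hρ) (sq_nonneg _)

end MorreyThreshold

/-! ### The small-scale Morrey bound from the high-frequency envelope -/

/-- **The Morrey constant at small scales is governed by the high-frequency envelope** (statement
and proof in the module docstring): with `κ₂ = 216 |B₁|³ + 18 |B₁|`, a continuous polynomially
decaying coefficient field with `‖ξ‖² ‖f ξ‖ ≤ C` everywhere and `≤ δ` for `‖ξ‖ ≥ R` has
`∫_{B_r(x₁)} ‖synthVel f‖² ≤ κ₂ δ² r` whenever `r R ≤ 1` and `C R r ≤ δ`. [folklore] -/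
theorem morrey_of_envelope_highFreq :
    ∃ κ₂ : ℝ, 0 ≤ κ₂ ∧ ∀ (C δ R : ℝ) (f : EuclideanSpace ℝ (Fin 3) → Fin 3 → ℂ),
      0 ≤ C → 0 ≤ δ → 0 < R → Continuous f →
      (∀ K : ℕ, ∃ B : ℝ, Literature.Analysis.FluidPDE.FourierNS.HasDecay K B f) →
      (∀ ξ : EuclideanSpace ℝ (Fin 3), ‖ξ‖ ^ 2 * ‖f ξ‖ ≤ C) →
      (∀ ξ : EuclideanSpace ℝ (Fin 3), R ≤ ‖ξ‖ → ‖ξ‖ ^ 2 * ‖f ξ‖ ≤ δ) →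
      ∀ (x₁ : EuclideanSpace ℝ (Fin 3)) (r : ℝ), 0 < r → r * R ≤ 1 → C * R * r ≤ δ →
        ∫ x in Metric.ball x₁ r, ‖Literature.Analysis.FluidPDE.FourierNS.synthVel f x‖ ^ 2 ≤
          κ₂ * δ ^ 2 * r := by
  have hVB0 : 0 ≤ (volume (ball (0 : (EuclideanSpace ℝ (Fin 3))) 1)).toReal := ENNReal.toReal_nonneg
  refine ⟨216 * (volume (ball (0 : (EuclideanSpace ℝ (Fin 3))) 1)).toReal ^ 3 + 18 * (volume (ball (0 : (EuclideanSpace ℝ (Fin 3))) 1)).toReal,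
    by positivity, ?_⟩
  intro C δ R f hC hδ hR hf hdec henv htail x₁ r hr hrR hCRr
  set VB : ℝ := (volume (ball (0 : (EuclideanSpace ℝ (Fin 3))) 1)).toReal with hVB
  have hr0 : r ≠ 0 := hr.ne'
  have hρ : 0 < r⁻¹ := inv_pos.2 hr
  have hRρ : R ≤ r⁻¹ := by
    rw [le_inv_comm₀ hR hr]
    calc r = r * R / R := by field_simp
      _ ≤ 1 / R := by gcongr
      _ = R⁻¹ := one_div R
  obtain ⟨B, hB⟩ := hdec 4
  have h3 : Fintype.card (Fin 3) < 4 := by simp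
  have hSm : MeasurableSet {ξ : (EuclideanSpace ℝ (Fin 3)) | ‖ξ‖ ≤ r⁻¹} :=
    (isClosed_le continuous_norm continuous_const).measurableSet
  -- the two envelopes off the origin, componentwise
  have henv' : ∀ (l : Fin 3) (ξ : (EuclideanSpace ℝ (Fin 3))), ξ ≠ 0 → ‖f ξ l‖ ≤ C * (‖ξ‖ ^ 2)⁻¹ := by
    intro l ξ hξ
    have hξ2 : 0 < ‖ξ‖ ^ 2 := pow_pos (norm_pos_iff.2 hξ) 2
    calc ‖f ξ l‖ ≤ ‖f ξ‖ := norm_le_pi_norm (f ξ) l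
      _ ≤ C * (‖ξ‖ ^ 2)⁻¹ := by
          rw [← div_eq_mul_inv, le_div_iff₀ hξ2, mul_comm]
          exact henv ξ
  have htail' : ∀ (l : Fin 3) (ξ : (EuclideanSpace ℝ (Fin 3))), R ≤ ‖ξ‖ → ‖f ξ l‖ ≤ δ * (‖ξ‖ ^ 2)⁻¹ := by
    intro l ξ hξ
    have hξ2 : 0 < ‖ξ‖ ^ 2 := pow_pos (hR.trans_le hξ) 2
    calc ‖f ξ l‖ ≤ ‖f ξ‖ := norm_le_pi_norm (f ξ) l
      _ ≤ δ * (‖ξ‖ ^ 2)⁻¹ := by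
          rw [← div_eq_mul_inv, le_div_iff₀ hξ2, mul_comm]
          exact htail ξ hξ
  have htailρ : ∀ (l : Fin 3) (ξ : (EuclideanSpace ℝ (Fin 3))), r⁻¹ < ‖ξ‖ → ‖f ξ l‖ ≤ δ * (‖ξ‖ ^ 2)⁻¹ :=
    fun l ξ hξ => htail' l ξ (hRρ.trans hξ.le)
  -- the components and their two frequency pieces
  have hFc : ∀ l : Fin 3, Continuous fun ξ : (EuclideanSpace ℝ (Fin 3)) => f ξ l := fun l => (continuous_apply l).comp hf
  have hFd : ∀ l : Fin 3, HasDecay 4 B (fun ξ : (EuclideanSpace ℝ (Fin 3)) => f ξ l) := fun l => hB.apply l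
  have hFi : ∀ l : Fin 3, Integrable (fun ξ : (EuclideanSpace ℝ (Fin 3)) => f ξ l) := fun l =>
    (hFd l).integrable (finrank_lt_of_card_lt h3) (hFc l).aestronglyMeasurable
  have hloi : ∀ l : Fin 3, Integrable ({ξ : (EuclideanSpace ℝ (Fin 3)) | ‖ξ‖ ≤ r⁻¹}.indicator fun ξ : (EuclideanSpace ℝ (Fin 3)) => f ξ l) :=
    fun l => (hFi l).indicator hSm
  have hhii : ∀ l : Fin 3, Integrable ({ξ : (EuclideanSpace ℝ (Fin 3)) | ‖ξ‖ ≤ r⁻¹}ᶜ.indicator fun ξ : (EuclideanSpace ℝ (Fin 3)) => f ξ l) :=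
    fun l => (hFi l).indicator hSm.compl
  have hsplit : ∀ (l : Fin 3) (x : (EuclideanSpace ℝ (Fin 3))), synthVel f x l =
      (𝓕 ({ξ : (EuclideanSpace ℝ (Fin 3)) | ‖ξ‖ ≤ r⁻¹}.indicator fun ξ : (EuclideanSpace ℝ (Fin 3)) => f ξ l) x).re +
        (𝓕 ({ξ : (EuclideanSpace ℝ (Fin 3)) | ‖ξ‖ ≤ r⁻¹}ᶜ.indicator fun ξ : (EuclideanSpace ℝ (Fin 3)) => f ξ l) x).re := by
    intro l x
    rw [synthVel_apply, ← Complex.add_re, ← fourier_add' (hloi l) (hhii l),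
      indicator_self_add_compl]
  -- the two bounds; in the stated range of radii `C R + δ r⁻¹ ≤ 2 δ r⁻¹`
  set L : ℝ := 3 * VB * (C * R + δ * r⁻¹) with hL
  have hLle : L ≤ 3 * VB * (2 * δ * r⁻¹) := by
    rw [hL]
    refine mul_le_mul_of_nonneg_left ?_ (by positivity)
    have : C * R ≤ δ * r⁻¹ := by
      rw [← div_eq_mul_inv, le_div_iff₀ hr]
      exact hCRr
    linarith
  have hL0 : 0 ≤ L := by rw [hL]; positivity
  have hlow : ∀ (l : Fin 3) (x : (EuclideanSpace ℝ (Fin 3))),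
      (𝓕 ({ξ : (EuclideanSpace ℝ (Fin 3)) | ‖ξ‖ ≤ r⁻¹}.indicator fun ξ : (EuclideanSpace ℝ (Fin 3)) => f ξ l) x).re ^ 2 ≤ L ^ 2 :=
    fun l x => MorreyThreshold.sq_re_fourier_low_le_of_tail hC hδ hR hRρ (hFi l) (henv' l)
      (htail' l) x
  have hhigh : ∀ l : Fin 3,
      ∫⁻ x, ENNReal.ofReal ((𝓕 ({ξ : (EuclideanSpace ℝ (Fin 3)) | ‖ξ‖ ≤ r⁻¹}ᶜ.indicator fun ξ : (EuclideanSpace ℝ (Fin 3)) => f ξ l) x).re ^ 2) ≤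
        ENNReal.ofReal (δ ^ 2 * (3 * VB * r⁻¹⁻¹)) :=
    fun l => MorreyThreshold.lintegral_sq_re_fourier_high_le_of_tail hρ (hFc l) (hFd l) (htailρ l)
  have hbm : ∀ l : Fin 3, Measurable fun x : (EuclideanSpace ℝ (Fin 3)) =>
      ENNReal.ofReal ((𝓕 ({ξ : (EuclideanSpace ℝ (Fin 3)) | ‖ξ‖ ≤ r⁻¹}ᶜ.indicator fun ξ : (EuclideanSpace ℝ (Fin 3)) => f ξ l) x).re ^ 2) :=
    fun l => ((MorreySharp.continuous_re_fourier_high r⁻¹ (hFc l) (hFd l)).pow 2).measurable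
      |>.ennreal_ofReal
  -- pointwise bound of the integrand
  have hpt : ∀ x : (EuclideanSpace ℝ (Fin 3)), ENNReal.ofReal (‖synthVel f x‖ ^ 2) ≤ ENNReal.ofReal (6 * L ^ 2) +
      2 * ∑ l : Fin 3, ENNReal.ofReal
        ((𝓕 ({ξ : (EuclideanSpace ℝ (Fin 3)) | ‖ξ‖ ≤ r⁻¹}ᶜ.indicator fun ξ : (EuclideanSpace ℝ (Fin 3)) => f ξ l) x).re ^ 2) := by
    intro x
    have h2 : ∀ l : Fin 3, synthVel f x l ^ 2 ≤ 2 * L ^ 2 +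
        2 * (𝓕 ({ξ : (EuclideanSpace ℝ (Fin 3)) | ‖ξ‖ ≤ r⁻¹}ᶜ.indicator fun ξ : (EuclideanSpace ℝ (Fin 3)) => f ξ l) x).re ^ 2 := by
      intro l
      rw [hsplit l x]
      nlinarith [hlow l x,
        sq_nonneg ((𝓕 ({ξ : (EuclideanSpace ℝ (Fin 3)) | ‖ξ‖ ≤ r⁻¹}.indicator fun ξ : (EuclideanSpace ℝ (Fin 3)) => f ξ l) x).re -
          (𝓕 ({ξ : (EuclideanSpace ℝ (Fin 3)) | ‖ξ‖ ≤ r⁻¹}ᶜ.indicator fun ξ : (EuclideanSpace ℝ (Fin 3)) => f ξ l) x).re)]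
    calc ENNReal.ofReal (‖synthVel f x‖ ^ 2)
        ≤ ENNReal.ofReal (6 * L ^ 2 + 2 * ∑ l : Fin 3,
            (𝓕 ({ξ : (EuclideanSpace ℝ (Fin 3)) | ‖ξ‖ ≤ r⁻¹}ᶜ.indicator fun ξ : (EuclideanSpace ℝ (Fin 3)) => f ξ l) x).re ^ 2) := by
          refine ENNReal.ofReal_le_ofReal ?_
          rw [EuclideanSpace.real_norm_sq_eq]
          calc ∑ l, synthVel f x l ^ 2
              ≤ ∑ l : Fin 3, (2 * L ^ 2 +
                  2 * (𝓕 ({ξ : (EuclideanSpace ℝ (Fin 3)) | ‖ξ‖ ≤ r⁻¹}ᶜ.indicator fun ξ : (EuclideanSpace ℝ (Fin 3)) => f ξ l) x).re ^ 2) :=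
                Finset.sum_le_sum fun l _ => h2 l
            _ = _ := by
                rw [Finset.sum_add_distrib, Finset.sum_const, Finset.card_univ, Fintype.card_fin,
                  nsmul_eq_mul, Nat.cast_ofNat, ← Finset.mul_sum]
                ring
      _ = _ := by
          rw [ENNReal.ofReal_add (by positivity) (by positivity), ENNReal.ofReal_mul zero_le_two,
            ENNReal.ofReal_ofNat, ENNReal.ofReal_sum_of_nonneg fun l _ => sq_nonneg _]
  -- integration over the ball
  have hmeas_sv : AEStronglyMeasurable (fun x : (EuclideanSpace ℝ (Fin 3)) => ‖synthVel f x‖ ^ 2)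
      (volume.restrict (ball x₁ r)) :=
    ((contDiff_synthVel f hf hdec).continuous.norm.pow 2).aestronglyMeasurable
  have hvol : volume (ball x₁ r) = ENNReal.ofReal (r ^ 3) * ENNReal.ofReal VB := by
    rw [Measure.addHaar_ball_of_pos volume x₁ hr, TightEnvelope.finrank_euclideanSpace_fin_three,
      hVB, ENNReal.ofReal_toReal measure_ball_lt_top.ne]
  have hprod : ENNReal.ofReal (6 * L ^ 2) * volume (ball x₁ r) =
      ENNReal.ofReal (6 * L ^ 2 * (r ^ 3 * VB)) := by
    rw [hvol, ← ENNReal.ofReal_mul (by positivity : (0 : ℝ) ≤ r ^ 3),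
      ← ENNReal.ofReal_mul (by positivity : (0 : ℝ) ≤ 6 * L ^ 2)]
  have hsum : (2 : ℝ≥0∞) * ∑ _l : Fin 3, ENNReal.ofReal (δ ^ 2 * (3 * VB * r⁻¹⁻¹)) =
      ENNReal.ofReal (6 * (δ ^ 2 * (3 * VB * r⁻¹⁻¹))) := by
    rw [Finset.sum_const, Finset.card_univ, Fintype.card_fin, nsmul_eq_mul, Nat.cast_ofNat,
      ENNReal.ofReal_mul (by norm_num : (0 : ℝ) ≤ 6), ENNReal.ofReal_ofNat]
    ring
  have hmain : ∫⁻ x in ball x₁ r, ENNReal.ofReal (‖synthVel f x‖ ^ 2) ≤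
      ENNReal.ofReal (6 * L ^ 2 * (r ^ 3 * VB) + 6 * (δ ^ 2 * (3 * VB * r⁻¹⁻¹))) := by
    calc ∫⁻ x in ball x₁ r, ENNReal.ofReal (‖synthVel f x‖ ^ 2)
        ≤ ∫⁻ x in ball x₁ r, (ENNReal.ofReal (6 * L ^ 2) + 2 * ∑ l : Fin 3, ENNReal.ofReal
            ((𝓕 ({ξ : (EuclideanSpace ℝ (Fin 3)) | ‖ξ‖ ≤ r⁻¹}ᶜ.indicator fun ξ : (EuclideanSpace ℝ (Fin 3)) => f ξ l) x).re ^ 2)) :=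
          lintegral_mono fun x => hpt x
      _ = ENNReal.ofReal (6 * L ^ 2) * volume (ball x₁ r) +
            2 * ∑ l : Fin 3, ∫⁻ x in ball x₁ r, ENNReal.ofReal
              ((𝓕 ({ξ : (EuclideanSpace ℝ (Fin 3)) | ‖ξ‖ ≤ r⁻¹}ᶜ.indicator fun ξ : (EuclideanSpace ℝ (Fin 3)) => f ξ l) x).re ^ 2) := by
          rw [lintegral_add_left measurable_const, lintegral_const, Measure.restrict_apply_univ,
            lintegral_const_mul _ (Finset.measurable_fun_sum _ fun l _ => hbm l),
            lintegral_finsetSum _ fun l _ => hbm l]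
      _ ≤ ENNReal.ofReal (6 * L ^ 2) * volume (ball x₁ r) +
            2 * ∑ _l : Fin 3, ENNReal.ofReal (δ ^ 2 * (3 * VB * r⁻¹⁻¹)) := by
          gcongr
          exact (setLIntegral_le_lintegral _ _).trans (hhigh _)
      _ = _ := by
          rw [hprod, hsum, ← ENNReal.ofReal_add (by positivity) (by positivity)]
  rw [integral_eq_lintegral_of_nonneg_ae (Eventually.of_forall fun x => sq_nonneg _) hmeas_sv]
  refine ENNReal.toReal_le_of_le_ofReal (by positivity) (hmain.trans ?_)
  refine ENNReal.ofReal_le_ofReal ?_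
  rw [inv_inv]
  -- `6 L² r³ VB + 18 VB δ² r ≤ (216 VB³ + 18 VB) δ² r` since `L ≤ 6 VB δ / r`
  have hL2 : L ^ 2 ≤ (3 * VB * (2 * δ * r⁻¹)) ^ 2 := pow_le_pow_left₀ hL0 hLle 2
  have hkey : 6 * L ^ 2 * (r ^ 3 * VB) ≤ 216 * VB ^ 3 * δ ^ 2 * r := by
    calc 6 * L ^ 2 * (r ^ 3 * VB) ≤ 6 * (3 * VB * (2 * δ * r⁻¹)) ^ 2 * (r ^ 3 * VB) := by
          gcongr
      _ = 216 * VB ^ 3 * δ ^ 2 * r := by field_simp; ring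
  calc 6 * L ^ 2 * (r ^ 3 * VB) + 6 * (δ ^ 2 * (3 * VB * r))
      ≤ 216 * VB ^ 3 * δ ^ 2 * r + 6 * (δ ^ 2 * (3 * VB * r)) := by linarith
    _ = (216 * VB ^ 3 + 18 * VB) * δ ^ 2 * r := by ring

end Summit.NavierStokesRegularity.NavierStokesRegularity.Theorems.BoundedEnvelope

end
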